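import Summits.AnomalousDissipation.AnomalousDissipation.Theorems.ImpulseGridGridSignsKickBudgetTransfer
import Summits.AnomalousDissipation.AnomalousDissipation.Theorems.ImpulseGridGridSignsHierarchy

/-!
# Crux `GridSigns` (stmt-AnomalousDissipation-1771) — line `SketchIdeator2`: skeleton v3 (KICK BUDGET form)

Line `SketchIdeator2` (crux-ideate round 1, ideator 2; card `shape-constant-split`), lead c1.
Everything provable in the line is LANDED:
* `stub_kickInjectionIdentity` (p114982) — the spatial KICK formula (`H•G`-tested momentum balance);
* `stub_slabFactorization` (p114681) — `∫a‖G‖² = (∫a)(∫‖G‖²)` for slab weights;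
* `stub_ceilingsYoungBound` (p115804) — Young/strain wake-energy CEILINGS under `Λ`;
* `detunedWorkIdentity`, `gridSigns_of_quietWakes` (p116272) — the CEILINGS transfer (v1/v2 stub);
* `gridSigns_of_kickBudget` (p127164) — the KICK-BUDGET transfer used below;
* `gridSigns_of_gridThesis`, `boundedEnergyGrid_of_gridSigns` (p116072) — the crux's place in the
  route: `GridThesis → GridSigns → BoundedEnergyGrid` (every witness of the crux is a bounded-energy
  fixed-force family, stmt-10430, with an injection floor by `GridInjectionIdentity`).

v3 RESHAPE (why): the v2 existence stub `stub_quietWakes` asked for ENERGY ceilings (window, slab,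
arc, bulk) with a positive Young-form kick margin. The lead's toy DNS (kit j019000; sweep j020100)
shows that the slab ceiling `Gmax·Λ∫Φ|w|²` ALONE exceeds the free kick `(∫ΦH)‖G‖₂²` in the
impulsive regime — necessarily so: the fresh imprint `ΨG/c` right behind the slab has energy
density `≈ A²` there — while the cross-moment it bounds, `Λ(Φw₀⟪G,u⟫)`, is two orders of magnitude
smaller (decorrelation of `w₀` and `⟪G,w⟫`, not quietness). So the honest existence bet is the
BUDGET form: the five exact, physically named terms of the kick formula (returning-stream
correlation, window/slab cross-moments, arc production, resonant response) budgeted against the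
free kick. `stub_kickBudgetWakes` below is that statement (= the hypothesis of
`gridSigns_of_kickBudget` verbatim); it is conjecture-grade for the same reason as before
(bounded energy at fixed force + injection floor), and each of its clauses is a column of the DNS
table attached to the item.

* `stub_kickBudgetWakes` — EXISTENCE (lead; conjecture-grade). Single sorry.
* `GridSigns_of` — `gridSigns_of_kickBudget stub_kickBudgetWakes`, concluding the crux by name.
-/

noncomputable section

-- `Summit.<Summit>.<Problem>` is the tree's mandated summit-side namespace (CONVENTIONS §2); for this
-- single-conjunct summit the two coincide, so the duplicate is deliberate.
set_option linter.dupNamespace false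

open MeasureTheory Set Filter Topology
open scoped InnerProductSpace RealInnerProductSpace

namespace Summit.AnomalousDissipation.AnomalousDissipation.Theorems.GridSignsCeilings

open Literature.Analysis
open Literature.Analysis.FluidPDE Literature.Analysis.FluidPDE.Torus
open Literature.Analysis.FunctionSpaces Literature.Analysis.FunctionSpaces.Torus
open Summit.AnomalousDissipation.AnomalousDissipation.Theses.ImpulseGrid

/-- **Stub (existence; the physical bet of route ImpulseGrid in KICK-BUDGET form; lead).** A
slab⊗transverse design `(Φ, Ψ, G)` with the design clauses of `GridSigns`, a window weight `χ`
and kick test function `H` (`∂₀H = χ − Φ`), budgets `ρ₁, ρ₂, ρ₃, ρ₄, ρₐ` with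
`(∫ΦH)‖G‖₂² − ρ₁ − ρ₂ − ρ₃ − ρ₄ − ρₐ ≥ 2η > 0`, and a vanishing-viscosity global Leray–Hopf drift
family (per-`j` sup-energy bounds, `ν`-uniformly bounded mean energy, drift data `∫u₀ⱼ = c e₀`)
with, in one generalized limit `Λ`: NO REVERSAL `0 ≤ Λ(G,uⱼ)`, resonant response `c·Λ(G,uⱼ) ≤ ρₐ`,
returning-stream correlation `c·Λ(χ⟪G,uⱼ⟫) ≥ −ρ₁`, cross-moments `Λ(χw₀⟪G,uⱼ⟫) ≥ −ρ₂`,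
`Λ(Φw₀⟪G,uⱼ⟫) ≤ ρ₃`, arc production `Λ(H⟪wⱼ,(wⱼ·∇)G⟫) ≥ −ρ₄`. Conjecture-grade: any witness is
a bounded-energy fixed-force family with an injection floor. [folklore] -/
theorem stub_kickBudgetWakes :
    ∃ (Φ Ψ χ H : UnitAddTorus (Fin 3) → ℝ) (G : UnitAddTorus (Fin 3) → EuclideanSpace ℝ (Fin 3))
      (c ρ₁ ρ₂ ρ₃ ρ₄ ρₐ η : ℝ),
      IsSmooth Φ ∧ IsSmooth Ψ ∧ IsSmooth G ∧
      (∀ (s : UnitAddCircle) x, Ψ (x + Pi.single (1 : Fin 3) s) = Ψ x ∧ Ψ (x + Pi.single (2 : Fin 3) s) = Ψ x) ∧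
      (∀ (s : UnitAddCircle) x, G (x + Pi.single (0 : Fin 3) s) = G x) ∧ (∀ x, G x 0 = 0) ∧ IsDivFree G ∧
      (∀ x, Torus.partialDeriv 0 Ψ x = Φ x - 1) ∧ (∫ x, Φ x * Ψ x * ‖G x‖ ^ 2 = 0) ∧
      IsSmooth (fun x => Φ x • G x) ∧ IsDivFree (fun x => Φ x • G x) ∧ HasZeroMean (fun x => Φ x • G x) ∧
      IsSmooth χ ∧ IsSmooth H ∧
      (∀ (s : UnitAddCircle) x, Φ (x + Pi.single (1 : Fin 3) s) = Φ x ∧ Φ (x + Pi.single (2 : Fin 3) s) = Φ x) ∧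
      (∀ (s : UnitAddCircle) x, H (x + Pi.single (1 : Fin 3) s) = H x ∧ H (x + Pi.single (2 : Fin 3) s) = H x) ∧
      (∀ x, Torus.partialDeriv 0 H x = χ x - Φ x) ∧
      0 < c ∧ 0 < η ∧
      2 * η ≤ (∫ x, Φ x * H x) * (∫ x, ‖G x‖ ^ 2) - ρ₁ - ρ₂ - ρ₃ - ρ₄ - ρₐ ∧
      ∃ (ν : ℕ → ℝ) (u₀ : ℕ → UnitAddTorus (Fin 3) → EuclideanSpace ℝ (Fin 3))
        (u : ℕ → ℝ → UnitAddTorus (Fin 3) → EuclideanSpace ℝ (Fin 3)) (Λ : GeneralizedLimit),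
        (∀ j, 0 < ν j) ∧ Tendsto ν atTop (nhds 0) ∧
        (∀ j, IsGlobalLerayHopf (ν j) (fun _ => fun x => Φ x • G x) (u₀ j) (u j)) ∧
        (∀ j, ∃ C : ℝ, ∀ t : ℝ, 0 ≤ t → kineticEnergy (u j t) ≤ C) ∧
        (∀ j, ∫ x, u₀ j x = c • EuclideanSpace.single 0 1) ∧
        (∃ E : ℝ, ∀ j, meanEnergy (u j) ≤ E) ∧
        (∀ j, 0 ≤ Λ.longTimeAvg (fun t => ∫ x, ⟪G x, u j t x⟫)) ∧
        (∀ j, c * Λ.longTimeAvg (fun t => ∫ x, ⟪G x, u j t x⟫) ≤ ρₐ) ∧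
        (∀ j, -ρ₁ ≤ c * Λ.longTimeAvg (fun t => ∫ x, χ x * ⟪G x, u j t x⟫)) ∧
        (∀ j, -ρ₂ ≤ Λ.longTimeAvg (fun t => ∫ x, χ x * ((u j t x - c • EuclideanSpace.single 0 1 : EuclideanSpace ℝ (Fin 3)) 0 * ⟪G x, u j t x⟫))) ∧
        (∀ j, Λ.longTimeAvg (fun t => ∫ x, Φ x * ((u j t x - c • EuclideanSpace.single 0 1 : EuclideanSpace ℝ (Fin 3)) 0 * ⟪G x, u j t x⟫)) ≤ ρ₃) ∧
        (∀ j, -ρ₄ ≤ Λ.longTimeAvg (fun t => ∫ x, H x * ⟪u j t x - c • EuclideanSpace.single 0 1,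
              Torus.convect (fun y => u j t y - c • EuclideanSpace.single 0 1) G x⟫)) := by
  sorry

/-- **Composition** (line `SketchIdeator2`, v3): the kick-budget existence stub and the landed
budget transfer `gridSigns_of_kickBudget` (p127164) conclude the crux `GridSigns`
(stmt-AnomalousDissipation-1771) by name. [folklore] -/
theorem GridSigns_of : GridSigns :=
  gridSigns_of_kickBudget stub_kickBudgetWakes

end Summit.AnomalousDissipation.AnomalousDissipation.Theorems.GridSignsCeilings

end
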